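import Mathlib
import Summits.KontsevichZagierPeriods.KontsevichZagierPeriods.Theorems.SoloBlindSubobjectTransfer

/-!
# Lifting subobjects through a functor that preserves images (solo-blind s69)

Companion to `SoloBlindSubobjectTransfer` (the injectivity half of (T3), `paper/inj-sectors.md` §3).
This file certifies the SURJECTIVITY mechanism actually used in THEOREM Inj_𝒮 (b)–(c) of the notes
(§4): on a Hodge-conjecture sector every `MM`-subobject of an effective motive `F M` is the image
of a PROJECTOR of `F M` (semisimplicity), every endomorphism of `F M` LIFTS to an endomorphism of
`M` (FACT Ch + HC), and a functor preserving images carries `image f` to `image (F f)`; hence every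
subobject of `F M` comes from `M` and, with (T3), the subobject lattices of `M` and `F M` are
isomorphic ("subquotient-closed image" at `M`).  The general statements certified here:

* `mk_map_imageSubobject_arrow` — if `F` preserves cospans and spans (e.g. preserves finite limits
  and finite colimits) between categories with images (target a strong-epi category, e.g. abelian),
  then `Subobject.mk (F.map (imageSubobject f).arrow) = imageSubobject (F.map f)`.
* `imageSubobject_retraction_comp` — a subobject `P` whose arrow has a retraction `r` is the image
  of the endomorphism `r ≫ P.arrow`.
* `exists_eq_of_image_lift`, `mk_map_arrow_surjective` — if every subobject of `F M` is the image of
  an endomorphism that lifts along `F`, then `P ↦ Subobject.mk (F.map P.arrow)` is SURJECTIVE onto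
  `Subobject (F.obj M)`; `mk_map_arrow_surjective_of_split` — the semisimple form (every subobject of
  `F M` split + every endomorphism of `F M` lifts).
* `subobjectIsoOfAbelian` — with `F` moreover faithful (so (T3) applies): an ORDER ISOMORPHISM
  `Subobject M ≃o Subobject (F.obj M)`.
* `idem_of_map_idem` — a faithful functor reflects idempotents (the lifted projector is a projector).

No fullness of `F` on all objects is assumed: the hypotheses are exactly the two inputs the notes
verify on HC-sectors (projectors exist downstairs, endomorphisms lift).  Off those sectors both
inputs are open (the statement `Inj` of the notes).  Bearing on the summit statement: none directly
(infrastructure for the paper-level THEOREM Inj_𝒮).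
-/

open CategoryTheory CategoryTheory.Limits

namespace Summit.KontsevichZagierPeriods.KontsevichZagierPeriods.Theorems
namespace SoloBlind
namespace SubobjectLift

universe v₁ v₂ u₁ u₂

variable {C : Type u₁} [Category.{v₁} C] {D : Type u₂} [Category.{v₂} D] (F : C ⥤ D)

/-- A faithful functor reflects idempotents: if `F f` is a projector then so is `f`. -/
theorem idem_of_map_idem [F.Faithful] {M : C} {f : M ⟶ M}
    (h : F.map f ≫ F.map f = F.map f) : f ≫ f = f :=
  F.map_injective (by rw [F.map_comp]; exact h)

/-- Hence a projector downstairs that lifts along a faithful `F` lifts to a PROJECTOR upstairs. -/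
theorem exists_idem_lift [F.Faithful] {M : C} (e : F.obj M ⟶ F.obj M) (he : e ≫ e = e)
    (hlift : ∀ e : F.obj M ⟶ F.obj M, ∃ f : M ⟶ M, F.map f = e) :
    ∃ f : M ⟶ M, f ≫ f = f ∧ F.map f = e := by
  obtain ⟨f, hf⟩ := hlift e
  exact ⟨f, idem_of_map_idem F (by rw [hf, he]), hf⟩

section images

variable [HasEqualizers C] [HasImages C] [StrongEpiCategory D] [HasImages D]
  [PreservesLimitsOfShape WalkingCospan F] [PreservesColimitsOfShape WalkingSpan F]

/-- A functor preserving cospans and spans carries the image subobject of `f` to the image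
subobject of `F f` (as subobjects of `F` of the target). -/
theorem mk_map_imageSubobject_arrow {N M : C} (f : N ⟶ M) :
    Subobject.mk (F.map (imageSubobject f).arrow) = imageSubobject (F.map f) := by
  have h1 : F.map (imageSubobject f).arrow =
      (F.mapIso (imageSubobjectIso f) ≪≫ (PreservesImage.iso F f).symm).hom ≫ image.ι (F.map f) := by
    rw [← imageSubobject_arrow, F.map_comp, ← PreservesImage.inv_comp_image_ι_map]
    simp
  exact Subobject.mk_eq_mk_of_comm _ _
    (F.mapIso (imageSubobjectIso f) ≪≫ (PreservesImage.iso F f).symm) h1.symm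

/-- Hence every image of a LIFTABLE morphism into `F M` comes from a subobject of `M`. -/
theorem exists_eq_of_image_lift {M : C} (P : Subobject (F.obj M))
    (hP : ∃ (N : C) (f : N ⟶ M), imageSubobject (F.map f) = P) :
    ∃ Q : Subobject M, Subobject.mk (F.map Q.arrow) = P := by
  obtain ⟨N, f, hf⟩ := hP
  exact ⟨imageSubobject f, by rw [mk_map_imageSubobject_arrow, hf]⟩

/-- If every subobject of `F M` is the image of an endomorphism of `F M` that lifts to `M`, then
`P ↦ Subobject.mk (F.map P.arrow)` is surjective onto `Subobject (F.obj M)`. -/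
theorem mk_map_arrow_surjective (M : C)
    (himg : ∀ P : Subobject (F.obj M), ∃ e : F.obj M ⟶ F.obj M, imageSubobject e = P)
    (hlift : ∀ e : F.obj M ⟶ F.obj M, ∃ f : M ⟶ M, F.map f = e) :
    Function.Surjective fun Q : Subobject M => Subobject.mk (F.map Q.arrow) := by
  intro P
  obtain ⟨e, he⟩ := himg P
  obtain ⟨f, hf⟩ := hlift e
  exact exists_eq_of_image_lift F P ⟨M, f, by rw [hf, he]⟩

end images

section retraction

variable [HasImages D]

/-- A subobject whose inclusion has a retraction `r` is the image of the endomorphism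
`r ≫ P.arrow` (the associated projector when `r` is the projection of a splitting). -/
theorem imageSubobject_retraction_comp {X : D} (P : Subobject X) (r : X ⟶ (P : D))
    (hr : P.arrow ≫ r = 𝟙 _) : imageSubobject (r ≫ P.arrow) = P := by
  apply le_antisymm
  · calc imageSubobject (r ≫ P.arrow) ≤ imageSubobject P.arrow := imageSubobject_comp_le _ _
      _ = P := by rw [imageSubobject_mono, Subobject.mk_arrow]
  · calc P = imageSubobject P.arrow := by rw [imageSubobject_mono, Subobject.mk_arrow]
      _ = imageSubobject (P.arrow ≫ (r ≫ P.arrow)) := by rw [← Category.assoc, hr, Category.id_comp]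
      _ ≤ imageSubobject (r ≫ P.arrow) := imageSubobject_comp_le _ _

/-- In particular every SPLIT subobject is the image of an endomorphism. -/
theorem exists_image_eq_of_isSplitMono {X : D} (P : Subobject X) (h : IsSplitMono P.arrow) :
    ∃ e : X ⟶ X, imageSubobject e = P := by
  obtain ⟨⟨r, hr⟩⟩ := h.exists_splitMono
  exact ⟨r ≫ P.arrow, imageSubobject_retraction_comp P r hr⟩

end retraction

section abelian

variable [Abelian C] [Abelian D] [PreservesFiniteLimits F] [PreservesFiniteColimits F]

/-- Semisimple form.  If every subobject of `F M` is split (e.g. `F M` is a semisimple object) and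
every endomorphism of `F M` lifts along `F`, then every subobject of `F M` comes from `M`. -/
theorem mk_map_arrow_surjective_of_split (M : C)
    (hsplit : ∀ P : Subobject (F.obj M), IsSplitMono P.arrow)
    (hlift : ∀ e : F.obj M ⟶ F.obj M, ∃ f : M ⟶ M, F.map f = e) :
    Function.Surjective fun Q : Subobject M => Subobject.mk (F.map Q.arrow) :=
  mk_map_arrow_surjective F M (fun P => exists_image_eq_of_isSplitMono P (hsplit P)) hlift

/-- With `F` moreover faithful, (T3) makes the map injective as well: the subobject lattices of `M`
and `F M` are ISOMORPHIC — "the image of `⟨M⟩` is closed under subobjects" in the notes. -/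
noncomputable def subobjectIsoOfAbelian [F.Faithful] (M : C)
    (himg : ∀ P : Subobject (F.obj M), ∃ e : F.obj M ⟶ F.obj M, imageSubobject e = P)
    (hlift : ∀ e : F.obj M ⟶ F.obj M, ∃ f : M ⟶ M, F.map f = e) :
    Subobject M ≃o Subobject (F.obj M) :=
  RelIso.ofSurjective (SubobjectTransfer.subobjectEmbeddingOfAbelian F M)
    (by
      intro P
      obtain ⟨Q, hQ⟩ := mk_map_arrow_surjective F M himg hlift P
      exact ⟨Q, by rw [← hQ]; rfl⟩)

/-- The isomorphism is `P ↦ Subobject.mk (F.map P.arrow)`. -/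
theorem subobjectIsoOfAbelian_apply [F.Faithful] (M : C)
    (himg : ∀ P : Subobject (F.obj M), ∃ e : F.obj M ⟶ F.obj M, imageSubobject e = P)
    (hlift : ∀ e : F.obj M ⟶ F.obj M, ∃ f : M ⟶ M, F.map f = e) (P : Subobject M) :
    subobjectIsoOfAbelian F M himg hlift P = Subobject.mk (F.map P.arrow) := rfl

/-- Semisimple form of the isomorphism (split subobjects downstairs, endomorphisms lift). -/
noncomputable def subobjectIsoOfSplit [F.Faithful] (M : C)
    (hsplit : ∀ P : Subobject (F.obj M), IsSplitMono P.arrow)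
    (hlift : ∀ e : F.obj M ⟶ F.obj M, ∃ f : M ⟶ M, F.map f = e) :
    Subobject M ≃o Subobject (F.obj M) :=
  subobjectIsoOfAbelian F M (fun P => exists_image_eq_of_isSplitMono P (hsplit P)) hlift

end abelian

end SubobjectLift
end SoloBlind
end Summit.KontsevichZagierPeriods.KontsevichZagierPeriods.Theorems
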